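import Literature.NumberTheory.ModularForms.SiegelHalfSpaceTwoAction
import Literature.NumberTheory.ModularForms.SiegelUpperHalfSpaceAction
import HarnessLib

/-!
# The degree-`2` coordinate action on `H₂ ⊂ ℝ⁶` is the Möbius action of `Sp_{2g}(ℝ)` on `𝔥_g`, `g = 2`

Compatibility sibling (lane `lit-hodgefound`, row Q60 = §I A2-36, prover p25; "a compatibility
lemma in degree 2 is welcome", lead 2026-08-21T06:07:40Z) of

* `ModularForms/SiegelHalfSpaceTwoAction.lean` (Klingen, Ch. I §1, in coordinates
  `x = (x₁₁, x₁₂, x₂₂, y₁₁, y₁₂, y₂₂) ∈ ℝ⁶`: the open set `Sp4Covolume.U = {y₁₁ > 0, y₁₂² < y₁₁y₂₂}`,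
  `toZ x = X + iY`, `smulZ g x = (AZ + B)(CZ + D)⁻¹`, `smulVec`, `MulAction Sp4R U`), and
* `ModularForms/SiegelUpperHalfSpaceAction.lean` (Lange 2023, Prop. 3.1.6: the `MulAction` of
  `Matrix.symplecticGroup (Fin g) ℝ` on the tree's `siegelUpperHalfSpace g` by
  `moeb P Z = (αZ + β)(γZ + δ)⁻¹`, all `g`).

Nothing is restated: we prove that the two constructions AGREE for `g = 2` — `smulZ g x` is
`moeb` of the complexified `g` at `toZ x` (definitionally), `x ∈ U ↔ toZ x ∈ 𝔥₂` (Sylvester's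
criterion for a real symmetric `2 × 2` matrix), and `x ↦ toZ x` is an injective `Sp₄(ℝ)`-equivariant
map `U → 𝔥₂`.

## References

* [Lange2023AbelianVarietiesComplex] H. Lange, *Abelian Varieties over the Complex Numbers* (2023),
  §3.1.3 Prop. 3.1.6 (held copy `book:lange1992-complex-abelian-varieties`, p0160).
* [Klingen1990] H. Klingen, *Introductory Lectures on Siegel Modular Forms*, CUP (1990), Ch. I §1.
-/

noncomputable section

open Matrix Complex

namespace Literature.NumberTheory.ModularForms

open Literature.NumberTheory.Automorphic (siegelUpperHalfSpace)

namespace SiegelUpperHalfSpace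

open Sp4Covolume

/-- **The coordinate action is the Möbius action**: Klingen's `g⟨Z⟩ = (AZ + B)(CZ + D)⁻¹` of
`SiegelHalfSpaceTwoAction.lean` is `moeb` of the complexified `g ∈ Sp₄(ℝ)` at `Z = toZ x`
(definitionally: both are `(αZ + β)(γZ + δ)⁻¹` with the blocks of `g`).
[cite: Lange2023AbelianVarietiesComplex, §3.1.3 Prop. 3.1.6 (p0160)] [cite: Klingen1990, Ch. I §1 Prop. 1] -/
theorem smulZ_eq_moeb (g : Sp4R) (x : Fin 6 → ℝ) :
    smulZ g x =
      moeb ((g : Matrix (Fin 2 ⊕ Fin 2) (Fin 2 ⊕ Fin 2) ℝ).map ((↑) : ℝ → ℂ)) (toZ x) :=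
  rfl

/-- `Im (toZ x) = Y = (y₁₁ y₁₂; y₁₂ y₂₂)`. [cite: Klingen1990, Ch. I §1] -/
theorem map_im_toZ (x : Fin 6 → ℝ) : (toZ x).map Complex.im = !![x 3, x 4; x 4, x 5] := by
  ext i j
  fin_cases i <;> fin_cases j <;> simp [Sp4Covolume.toZ]

/-- The quadratic form of `Y = (a b; b c)` at a real vector `v`:
`ᵗv Y v = a v₀² + 2b v₀v₁ + c v₁²`. [folklore] -/
private theorem dotProduct_mulVec_fin_two (a b c : ℝ) (v : Fin 2 → ℝ) :
    star v ⬝ᵥ (!![a, b; b, c] *ᵥ v) = a * v 0 ^ 2 + 2 * b * v 0 * v 1 + c * v 1 ^ 2 := by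
  simp [Matrix.mulVec, dotProduct, Fin.sum_univ_two, star_trivial]
  ring

/-- **`x ∈ U ↔ toZ x ∈ 𝔥₂`**: Klingen's coordinate half space `{y₁₁ > 0, y₁₂² < y₁₁y₂₂}` is the
degree-`2` Siegel upper half space `{Z = ᵗZ, Im Z ≻ 0}` (Sylvester's criterion for the real
symmetric `2 × 2` matrix `Y`). [cite: Klingen1990, Ch. I §1 ("H₂ = {Z = X + iY ∈ Sym₂(ℂ) : Y > 0}")]
[cite: Lange2023AbelianVarietiesComplex, §3.1.1 (definition of 𝔥_g) (p0158)] -/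
theorem toZ_mem_siegelUpperHalfSpace_iff (x : Fin 6 → ℝ) :
    toZ x ∈ siegelUpperHalfSpace 2 ↔ x ∈ U := by
  rw [Literature.NumberTheory.Automorphic.mem_siegelUpperHalfSpace_iff, map_im_toZ]
  have hsymm : (toZ x).IsSymm := toZ_transpose x
  have hH : (!![x 3, x 4; x 4, x 5] : Matrix (Fin 2) (Fin 2) ℝ).IsHermitian := by
    change (!![x 3, x 4; x 4, x 5] : Matrix (Fin 2) (Fin 2) ℝ)ᴴ = !![x 3, x 4; x 4, x 5]
    rw [conjTranspose_eq_transpose_of_trivial]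
    ext i j
    fin_cases i <;> fin_cases j <;> rfl
  constructor
  · rintro ⟨-, hpos⟩
    refine ⟨?_, ?_⟩
    · have h := hpos.dotProduct_mulVec_pos (x := Pi.single 0 1) (by simp)
      rw [dotProduct_mulVec_fin_two] at h
      simpa using h
    · have h := hpos.det_pos
      rw [Matrix.det_fin_two_of] at h
      nlinarith [h]
  · intro hx
    refine ⟨hsymm, PosDef.of_dotProduct_mulVec_pos hH fun v hv ↦ ?_⟩
    rw [dotProduct_mulVec_fin_two]
    refine yquad_pos hx ?_
    by_contra h
    simp only [not_or, not_not] at h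
    exact hv (funext fun i ↦ by fin_cases i <;> simp [h.1, h.2])

/-- **The comparison map `U → 𝔥₂`, `x ↦ toZ x = X + iY`.** [cite: Klingen1990, Ch. I §1] -/
def toSiegel (p : U) : siegelUpperHalfSpace 2 :=
  ⟨toZ p.1, (toZ_mem_siegelUpperHalfSpace_iff p.1).2 p.2⟩

/-- The comparison map on matrices. [cite: Klingen1990, Ch. I §1] -/
@[simp] theorem coe_toSiegel (p : U) :
    ((toSiegel p : siegelUpperHalfSpace 2) : Matrix (Fin 2) (Fin 2) ℂ) = toZ p.1 := rfl

/-- The comparison map is injective (`ofZ ∘ toZ = id`). [cite: Klingen1990, Ch. I §1] -/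
theorem toSiegel_injective : Function.Injective toSiegel := fun p q h ↦ by
  apply Subtype.ext
  have h' := congrArg (fun W : siegelUpperHalfSpace 2 ↦ ofZ (W : Matrix (Fin 2) (Fin 2) ℂ)) h
  simpa only [coe_toSiegel, ofZ_toZ] using h'

/-- Every point of `𝔥₂` is in the image (`toZ ∘ ofZ = id` on symmetric matrices): the comparison
map is a bijection `U ≃ 𝔥₂`. [cite: Klingen1990, Ch. I §1] -/
theorem toSiegel_surjective : Function.Surjective toSiegel := fun W ↦ by
  have hW : toZ (ofZ (W : Matrix (Fin 2) (Fin 2) ℂ)) = W := toZ_ofZ W.2.1.eq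
  refine ⟨⟨ofZ (W : Matrix (Fin 2) (Fin 2) ℂ), ?_⟩, Subtype.ext ?_⟩
  · rw [← toZ_mem_siegelUpperHalfSpace_iff, hW]; exact W.2
  · rw [coe_toSiegel, hW]

/-- **Equivariance**: the two `MulAction`s of `Sp₄(ℝ)` — Klingen's on `U ⊂ ℝ⁶`
(`Sp4Covolume.instMulActionU`) and Lange's Prop. 3.1.6 on `𝔥₂` (`SiegelUpperHalfSpace.instMulAction`)
— agree along `toSiegel`. [cite: Lange2023AbelianVarietiesComplex, §3.1.3 Prop. 3.1.6 (p0160)]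
[cite: Klingen1990, Ch. I §1 Prop. 1] -/
theorem toSiegel_smul (g : Sp4R) (p : U) : toSiegel (g • p) = g • toSiegel p := by
  apply Subtype.ext
  rw [coe_toSiegel, coe_smul, coe_toSiegel, ← smulZ_eq_moeb]
  exact toZ_smulVec g p.2

end SiegelUpperHalfSpace

end Literature.NumberTheory.ModularForms
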